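import Summits.NavierStokesRegularity.FunctionalMining.CrossedShearPressureRpow
import Summits.NavierStokesRegularity.FunctionalMining.GradPressureMomentRateRpow
import HarnessLib

/-!
# FunctionalMining — kernel no-go: the rows `EP.gradp.q|T_LD|G1` are FALSE for every κ at every real `q > 1` (W11)

Search for candidate a priori estimates; no regularity claim. Cell `pub-nsfunc`, prove seat
(gen 11). SIEVELD §2, Corollary W11 for the cores `∫|∇p|^q`, REAL `q > 1` (K0 rows `EP.gradp.q=3/2`,
`σ_F = 3/2, γ_F = 3`, and `EP.gradp.q=2`, `σ_F = 3, γ_F = 7/3`): at the reciprocal crossed shear `u_β`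
(`π_{u_β} = cc = cos 2πx₀ cos 2πx₁`, viscous source `A = −8π² h_β(x₂) cc`, `Δ⁻¹(h_β cc) = g_β(x₂) cc`,
files `CrossedShearPressure`, `CrossedShearPressureRpow`) the gradients `∇π = ∇cc` and
`∇Δ⁻¹A = −8π² ∇(g_β cc)` satisfy `⟪∇cc, ∇(g_β cc)⟫ = g_β(x₂) ‖∇cc‖²` pointwise (`∂₂ cc = 0`), so the
viscous rate of `∫‖∇π‖^q` (`gradPressureRpowViscousRate`, file `GradPressureMomentRateRpow`) is

`V_q(u_β) = −8π² q ∫ g_β(x₂) ‖∇cc‖^q = 4π² q (β² − 2) M_q`, `M_q = ∫_{T³} ‖∇cc‖^q > 0`,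

the oscillatory part `(β²/6) cos 4πx₂` of `g_β` integrating to zero against the `x₂`-independent
`‖∇cc‖^q` (translation `x₂ ↦ x₂ + 1/4`, Haar invariance). At `β = 2`, `V_q = 8π² q M_q > 0`, and
Theorem H (`HeatSieve`) kills `SaturatingLaw (∫‖∇π‖^q) σ γ κ` for every `κ`, `σ`, `γ ≥ 0` and every
real `q > 1` — in particular the K0 row `EP.gradp.q=3/2|T_LD|G1`. Explicit-witness no-go; nothing
about regularity.
-/

noncomputable section

open MeasureTheory Set Filter Topology Real
open scoped InnerProductSpace RealInnerProductSpace ContDiff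

namespace Summit.NavierStokesRegularity.FunctionalMining

open Literature.Analysis Literature.Analysis.FunctionSpaces Literature.Analysis.FunctionSpaces.Torus
open Literature.Analysis.FluidPDE

namespace CrossedShear

/-! ## 1. Gradients of `cc` and of `G = g_β(x₂) cc` -/

/-- `cc` is `C¹`. [folklore] -/
theorem isContDiff_cc : IsContDiff 1 cc := isSmooth_cc.isContDiff (by simp)

/-- `∂₀cc = −2π S(x₀)C(x₁)`. [folklore] -/
theorem partialDeriv_cc_zero (x : UnitAddTorus (Fin 3)) :
    Torus.partialDeriv 0 cc x = -(2 * π * sinP.onCircle (x 0)) * cosP.onCircle (x 1) := by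
  have h := partialDeriv_prod₂ cosP cosP 0 1 0 x
  have e : (fun y : UnitAddTorus (Fin 3) => cosP.onCircle (y 0) * cosP.onCircle (y 1)) = cc := rfl
  rw [e] at h
  rw [h, cosP_D_onCircle]
  have h2 : ¬ ((0 : Fin 3) = 1) := by decide
  simp only [if_true, h2, if_false, mul_zero, add_zero]

/-- `∂₁cc = −2π C(x₀)S(x₁)`. [folklore] -/
theorem partialDeriv_cc_one (x : UnitAddTorus (Fin 3)) :
    Torus.partialDeriv 1 cc x = -(2 * π * sinP.onCircle (x 1)) * cosP.onCircle (x 0) := by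
  have h := partialDeriv_prod₂ cosP cosP 0 1 1 x
  have e : (fun y : UnitAddTorus (Fin 3) => cosP.onCircle (y 0) * cosP.onCircle (y 1)) = cc := rfl
  rw [e] at h
  rw [h]
  have h2 : ¬ ((1 : Fin 3) = 0) := by decide
  simp only [if_true, h2, if_false, zero_mul, zero_add]
  rw [cosP_D_onCircle]
  ring

/-- `∂₂cc = 0`. [folklore] -/
theorem partialDeriv_cc_two (x : UnitAddTorus (Fin 3)) : Torus.partialDeriv 2 cc x = 0 := by
  have h := partialDeriv_prod₂ cosP cosP 0 1 2 x
  have e : (fun y : UnitAddTorus (Fin 3) => cosP.onCircle (y 0) * cosP.onCircle (y 1)) = cc := rfl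
  rw [e] at h
  rw [h]
  have h1 : ¬ ((2 : Fin 3) = 0) := by decide
  have h2 : ¬ ((2 : Fin 3) = 1) := by decide
  simp only [h1, h2, if_false, zero_mul, mul_zero, add_zero]

/-- The gradient of `cc` in coordinates. [folklore] -/
theorem gradient_cc_apply (x : UnitAddTorus (Fin 3)) (j : Fin 3) :
    Torus.gradient cc x j = Torus.partialDeriv j cc x :=
  GradientTensor.gradient_apply_eq_partialDeriv isContDiff_cc x j

/-- `‖∇cc‖² = (∂₀cc)² + (∂₁cc)²`. [folklore] -/
theorem norm_gradient_cc_sq (x : UnitAddTorus (Fin 3)) :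
    ‖Torus.gradient cc x‖ ^ 2 =
      Torus.partialDeriv 0 cc x * Torus.partialDeriv 0 cc x +
        Torus.partialDeriv 1 cc x * Torus.partialDeriv 1 cc x := by
  rw [norm_gradient_sq_eq_sum isContDiff_cc, Fin.sum_univ_three, partialDeriv_cc_two, mul_zero, add_zero]

/-- The gradient of `cc` does not see `x₂`: `∇cc(x + c e₂) = ∇cc(x)`. [folklore] -/
theorem gradient_cc_add_single_two (x : UnitAddTorus (Fin 3)) (c : UnitAddCircle) :
    Torus.gradient cc (x + Pi.single 2 c) = Torus.gradient cc x := by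
  have h0 : (x + Pi.single (2 : Fin 3) c : UnitAddTorus (Fin 3)) 0 = x 0 := by simp
  have h1 : (x + Pi.single (2 : Fin 3) c : UnitAddTorus (Fin 3)) 1 = x 1 := by simp
  ext j
  rw [gradient_cc_apply, gradient_cc_apply]
  fin_cases j
  · show Torus.partialDeriv 0 cc _ = Torus.partialDeriv 0 cc x
    rw [partialDeriv_cc_zero, partialDeriv_cc_zero, h0, h1]
  · show Torus.partialDeriv 1 cc _ = Torus.partialDeriv 1 cc x
    rw [partialDeriv_cc_one, partialDeriv_cc_one, h0, h1]
  · show Torus.partialDeriv 2 cc _ = Torus.partialDeriv 2 cc x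
    rw [partialDeriv_cc_two, partialDeriv_cc_two]

/-- `G = g_β(x₂) cc` is `C¹`. [folklore] -/
theorem isContDiff_Gfun (β : ℝ) : IsContDiff 1 (Gfun β) := (isSmooth_Gfun β).isContDiff (by simp)

/-- `∂₀G = g_β(x₂) ∂₀cc`. [folklore] -/
theorem partialDeriv_Gfun_zero (β : ℝ) (x : UnitAddTorus (Fin 3)) :
    Torus.partialDeriv 0 (Gfun β) x = (gP β).onCircle (x 2) * Torus.partialDeriv 0 cc x := by
  have hG : Gfun β = fun y : UnitAddTorus (Fin 3) =>
      (gP β).onCircle (y 2) * (cosP.onCircle (y 0) * cosP.onCircle (y 1)) := rfl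
  rw [hG, partialDeriv_zero_prod₃, partialDeriv_cc_zero, cosP_D_onCircle]

/-- `∂₁G = g_β(x₂) ∂₁cc`. [folklore] -/
theorem partialDeriv_Gfun_one (β : ℝ) (x : UnitAddTorus (Fin 3)) :
    Torus.partialDeriv 1 (Gfun β) x = (gP β).onCircle (x 2) * Torus.partialDeriv 1 cc x := by
  have hG : Gfun β = fun y : UnitAddTorus (Fin 3) =>
      (gP β).onCircle (y 2) * (cosP.onCircle (y 0) * cosP.onCircle (y 1)) := rfl
  rw [hG, partialDeriv_one_prod₃, partialDeriv_cc_one, cosP_D_onCircle]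
  ring

/-- `∂₂G = g_β'(x₂) cc`. [folklore] -/
theorem partialDeriv_Gfun_two (β : ℝ) (x : UnitAddTorus (Fin 3)) :
    Torus.partialDeriv 2 (Gfun β) x = (gP β).D.onCircle (x 2) * cc x := by
  have hG : Gfun β = fun y : UnitAddTorus (Fin 3) =>
      (gP β).onCircle (y 2) * (cosP.onCircle (y 0) * cosP.onCircle (y 1)) := rfl
  rw [hG, partialDeriv_two_prod₃, cc]

/-- **`⟪∇cc, ∇(c G)⟫ = c g_β(x₂) ‖∇cc‖²`** (`∂₂cc = 0`). [ours; elementary] -/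
theorem inner_gradient_cc_gradient_smul_Gfun (β c : ℝ) (x : UnitAddTorus (Fin 3)) :
    ⟪Torus.gradient cc x, Torus.gradient (c • Gfun β) x⟫_ℝ =
      c * (gP β).onCircle (x 2) * ‖Torus.gradient cc x‖ ^ 2 := by
  have hcG : IsContDiff 1 (c • Gfun β) := (isContDiff_Gfun β).smul c
  have hcoord : ∀ j, Torus.gradient (c • Gfun β) x j = c * Torus.partialDeriv j (Gfun β) x := by
    intro j
    rw [GradientTensor.gradient_apply_eq_partialDeriv hcG x j,
      Torus.partialDeriv_const_smul (isContDiff_Gfun β) c j, Pi.smul_apply, smul_eq_mul]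
  have hinner : ⟪Torus.gradient cc x, Torus.gradient (c • Gfun β) x⟫_ℝ =
      ∑ j, Torus.gradient cc x j * Torus.gradient (c • Gfun β) x j := by
    rw [PiLp.inner_apply]
    refine Finset.sum_congr rfl fun j _ => ?_
    simp [mul_comm]
  rw [hinner, Fin.sum_univ_three, hcoord, hcoord, hcoord, gradient_cc_apply, gradient_cc_apply,
    gradient_cc_apply, partialDeriv_Gfun_zero, partialDeriv_Gfun_one, partialDeriv_cc_two,
    norm_gradient_cc_sq]
  ring

/-! ## 2. The viscous rate of `∫‖∇π‖^q` at the crossed shear -/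

/-- `r^{q−2} r² = r^q` for `r ≥ 0`, `q ≠ 0`. [folklore] -/
theorem rpow_sub_two_mul_sq {r q : ℝ} (hr : 0 ≤ r) (hq : q ≠ 0) : r ^ (q - 2) * r ^ 2 = r ^ q := by
  rw [← Real.rpow_two, ← Real.rpow_add' hr (by rw [sub_add_cancel]; exact hq), sub_add_cancel]

/-- The integrand of `V_q` at the crossed shear, pointwise:
`q‖∇cc‖^{q−2}⟪∇cc, ∇Δ⁻¹A⟫ = −8π² q g_β(x₂) ‖∇cc‖^q`. [ours; elementary] -/
theorem gradPressureRpowViscousRate_integrand_cshear (β : ℝ) {q : ℝ} (hq : 0 < q)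
    (x : UnitAddTorus (Fin 3)) :
    q * ‖Torus.gradient (pressureOf (cshear β)) x‖ ^ (q - 2) *
        ⟪Torus.gradient (pressureOf (cshear β)) x,
          Torus.gradient (Torus.invLaplacian (pressureSqViscousSource (cshear β))) x⟫_ℝ =
      -(8 * π ^ 2) * q * ((gP β).onCircle (x 2) * ‖Torus.gradient cc x‖ ^ q) := by
  have hsrc : pressureSqViscousSource (cshear β) = (-(8 * π ^ 2)) • fun x => heatProfile β (x 2) * cc x := by
    funext y; rw [pressureSqViscousSource_cshear]; simp [smul_eq_mul]
  have hsm : IsSmooth (fun x : UnitAddTorus (Fin 3) => heatProfile β (x 2) * cc x) := by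
    have e : (fun x : UnitAddTorus (Fin 3) => heatProfile β (x 2) * cc x) = Torus.laplacian (Gfun β) := by
      funext y; rw [laplacian_Gfun]
    rw [e]; exact (isSmooth_Gfun β).laplacian
  rw [pressureOf_cshear, hsrc, Torus.invLaplacian_const_smul _ _ hsm, invLaplacian_heat_cc,
    inner_gradient_cc_gradient_smul_Gfun]
  have hpow := rpow_sub_two_mul_sq (norm_nonneg (Torus.gradient cc x)) hq.ne'
  calc q * ‖Torus.gradient cc x‖ ^ (q - 2) *
        (-(8 * π ^ 2) * (gP β).onCircle (x 2) * ‖Torus.gradient cc x‖ ^ 2)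
      = -(8 * π ^ 2) * q * ((gP β).onCircle (x 2) *
          (‖Torus.gradient cc x‖ ^ (q - 2) * ‖Torus.gradient cc x‖ ^ 2)) := by ring
    _ = _ := by rw [hpow]

/-- `x ↦ ‖∇cc x‖^q` is continuous for `q ≥ 0`. [folklore] -/
theorem continuous_norm_gradient_cc_rpow {q : ℝ} (hq : 0 ≤ q) :
    Continuous fun x : UnitAddTorus (Fin 3) => ‖Torus.gradient cc x‖ ^ q :=
  isSmooth_cc.gradient.continuous.norm.rpow_const fun _ => Or.inr hq

/-- `g_β` on the circle: `g_β = −(β²−2)/2 + (β²/6) cos2P`. [folklore] -/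
theorem gP_onCircle (β : ℝ) (b : UnitAddCircle) :
    (gP β).onCircle b = -((β ^ 2 - 2) / 2) + β ^ 2 / 6 * cos2P.onCircle b := by
  obtain ⟨t, rfl⟩ := QuotientAddGroup.mk_surjective b
  simp only [ShearProfile.onCircle_coe, gP_apply]

/-- `cos 4π(t + 1/4) = −cos 4πt` on the circle. [folklore] -/
theorem cos2P_onCircle_add_quarter (b : UnitAddCircle) :
    cos2P.onCircle (b + ((1 / 4 : ℝ) : UnitAddCircle)) = -cos2P.onCircle b := by
  obtain ⟨t, rfl⟩ := QuotientAddGroup.mk_surjective b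
  rw [← AddCircle.coe_add, ShearProfile.onCircle_coe, ShearProfile.onCircle_coe, cos2P_apply, cos2P_apply,
    show 4 * π * (t + 1 / 4) = 4 * π * t + π by ring, Real.cos_add_pi]

/-- **The oscillatory part integrates to zero**: `∫ cos 4πx₂ · ‖∇cc(x)‖^q dx = 0` (translation
`x₂ ↦ x₂ + 1/4` flips the sign of the integrand; Haar invariance). [ours; elementary] -/
theorem integral_cos2P_mul_norm_gradient_cc_rpow (q : ℝ) :
    ∫ x : UnitAddTorus (Fin 3), cos2P.onCircle (x 2) * ‖Torus.gradient cc x‖ ^ q = 0 := by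
  set F : UnitAddTorus (Fin 3) → ℝ := fun x => cos2P.onCircle (x 2) * ‖Torus.gradient cc x‖ ^ q with hF
  set e : UnitAddTorus (Fin 3) := Pi.single 2 ((1 / 4 : ℝ) : UnitAddCircle) with he
  have h1 : ∫ x, F (x + e) = ∫ x, F x := integral_add_right_eq_self F e
  have h2 : ∀ x, F (x + e) = -F x := by
    intro x
    simp only [hF]
    rw [gradient_cc_add_single_two]
    have : (x + e : UnitAddTorus (Fin 3)) 2 = x 2 + ((1 / 4 : ℝ) : UnitAddCircle) := by simp [he]
    rw [this, cos2P_onCircle_add_quarter]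
    ring
  simp_rw [h2, integral_neg] at h1
  show ∫ x, F x = 0
  linarith

/-- **`V_q(u_β) = 4π² q (β² − 2) M_q`**, `M_q = ∫‖∇cc‖^q`, for real `q > 0`. [ours] -/
theorem gradPressureRpowViscousRate_cshear (β : ℝ) {q : ℝ} (hq : 0 < q) :
    gradPressureRpowViscousRate q (cshear β) =
      4 * π ^ 2 * q * (β ^ 2 - 2) * ∫ x : UnitAddTorus (Fin 3), ‖Torus.gradient cc x‖ ^ q := by
  unfold gradPressureRpowViscousRate
  simp_rw [gradPressureRpowViscousRate_integrand_cshear β hq, gP_onCircle]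
  have hc := continuous_norm_gradient_cc_rpow hq.le
  have i1 : Integrable fun x : UnitAddTorus (Fin 3) => ‖Torus.gradient cc x‖ ^ q := hc.integrable_unitAddTorus
  have i2 : Integrable fun x : UnitAddTorus (Fin 3) => cos2P.onCircle (x 2) * ‖Torus.gradient cc x‖ ^ q :=
    ((continuous_onCircle_comp' cos2P (2 : Fin 3)).mul hc).integrable_unitAddTorus
  have e : ∀ x : UnitAddTorus (Fin 3),
      -(8 * π ^ 2) * q * ((-((β ^ 2 - 2) / 2) + β ^ 2 / 6 * cos2P.onCircle (x 2)) * ‖Torus.gradient cc x‖ ^ q) =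
      (4 * π ^ 2 * q * (β ^ 2 - 2)) * ‖Torus.gradient cc x‖ ^ q +
        (-(8 * π ^ 2) * q * (β ^ 2 / 6)) * (cos2P.onCircle (x 2) * ‖Torus.gradient cc x‖ ^ q) := by
    intro x; ring
  simp_rw [e]
  rw [integral_add (i1.const_mul _) (i2.const_mul _), integral_const_mul, integral_const_mul,
    integral_cos2P_mul_norm_gradient_cc_rpow, mul_zero, add_zero]

/-- **`M_q = ∫_{T³} ‖∇cc‖^q > 0`** (continuous, non-negative, and `‖∇cc‖ ≥ 2π` at `(1/4, 0, 0)`).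
[folklore] -/
theorem integral_norm_gradient_cc_rpow_pos {q : ℝ} (hq : 0 ≤ q) :
    0 < ∫ x : UnitAddTorus (Fin 3), ‖Torus.gradient cc x‖ ^ q := by
  have hc := continuous_norm_gradient_cc_rpow hq
  have h0 : ∀ x : UnitAddTorus (Fin 3), 0 ≤ ‖Torus.gradient cc x‖ ^ q := fun x =>
    Real.rpow_nonneg (norm_nonneg _) _
  rw [integral_pos_iff_support_of_nonneg h0 (hc.integrable_of_hasCompactSupport
    (HasCompactSupport.of_compactSpace _))]
  -- the point `x⋆ = (1/4, 0, 0)`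
  set xs : UnitAddTorus (Fin 3) := fun i => if i = 0 then (((1 / 4 : ℝ)) : UnitAddCircle) else ((0 : ℝ) : UnitAddCircle)
    with hxs
  refine (hc.isOpen_support).measure_pos volume ⟨xs, ?_⟩
  rw [Function.mem_support]
  have hx0 : xs 0 = ((1 / 4 : ℝ) : UnitAddCircle) := by simp [hxs]
  have hx1 : xs 1 = ((0 : ℝ) : UnitAddCircle) := by simp [hxs]
  have hg0 : Torus.gradient cc xs 0 = -(2 * π) := by
    rw [gradient_cc_apply, partialDeriv_cc_zero, hx0, hx1, ShearProfile.onCircle_coe,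
      ShearProfile.onCircle_coe, sinP_apply, cosP_apply, mul_zero, Real.cos_zero, mul_one,
      show 2 * π * (1 / 4 : ℝ) = π / 2 by ring, Real.sin_pi_div_two, mul_one]
  have hnorm : 2 * π ≤ ‖Torus.gradient cc xs‖ := by
    have h := PiLp.norm_apply_le (Torus.gradient cc xs) 0
    rw [Real.norm_eq_abs, hg0, abs_neg, abs_of_pos (by positivity)] at h
    exact h
  have hpos : 0 < ‖Torus.gradient cc xs‖ := lt_of_lt_of_le (by positivity) hnorm
  exact (Real.rpow_pos_of_pos hpos q).ne'

/-! ## 3. The no-go for every real `q > 1` -/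

/-- **Kernel no-go (SIEVELD §1–§2): `∫|∇p|^q` obeys NO saturating law, real `q > 1`.** For every
`κ`, every `σ` and every `γ ≥ 0`, `SaturatingLaw (torusGradPressureMoment q) σ γ κ` fails on `T³` —
at the crossed shear `u₂` the viscous initial rate of `∫‖∇π‖^q` is `V_q = 8π² q M_q > 0`
(Theorem H, `HeatSieve`). In particular the K0 rows `EP.gradp.q=3/2|T_LD|G1` (`σ = 3/2`, `γ = 3`) and
`EP.gradp.q=2|T_LD|G1` (`σ = 3`, `γ = 7/3`) are FALSE for every κ. Search for candidate a priori
estimates; no regularity claim. [ours; SIEVELD §1 Thm H, §2 Cor. W11] -/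
theorem not_saturatingLaw_gradPressureMoment_rpow {q : ℝ} (hq : 1 < q) {σ γ : ℝ} (hγ : 0 ≤ γ)
    (κ : ℝ) : ¬ SaturatingLaw (d := Fin 3) (torusGradPressureMoment q) σ γ κ := by
  have hq0 : 0 < q := by linarith
  have hM := integral_norm_gradient_cc_rpow_pos hq0.le
  have hV : 0 < gradPressureRpowViscousRate q (cshear 2) := by
    rw [gradPressureRpowViscousRate_cshear 2 hq0]
    have hπ2 : (0 : ℝ) < π ^ 2 := by positivity
    have : (0 : ℝ) < 4 * π ^ 2 * q * ((2 : ℝ) ^ 2 - 2) := by nlinarith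
    exact mul_pos this hM
  exact not_saturatingLaw_of_viscousRate_pos (hasInitialRate_torusGradPressureMoment_rpow hq) (by simp)
    (isSmooth_cshear 2) (isDivFree_cshear 2) (hasZeroMean_cshear 2) hV hγ κ

/-- **Row `EP.gradp.q=3/2|T_LD|G1` (K0: `σ_F = 3/2`, `γ_F = 3`) is FALSE for every κ.** [ours] -/
theorem not_saturatingLaw_gradPressureMoment_three_halves_row (κ : ℝ) :
    ¬ SaturatingLaw (d := Fin 3) (torusGradPressureMoment (3 / 2)) (3 / 2) 3 κ :=
  not_saturatingLaw_gradPressureMoment_rpow (by norm_num) (by norm_num) κ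

end CrossedShear

end Summit.NavierStokesRegularity.FunctionalMining
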